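import Mathlib
import Summits.Ventures.HodgeRepro2.T6A3Bridge
import Summits.Ventures.HodgeRepro2.T6A1EigenBasis

/-!
# T6A1Inputs — A1's handle for the M1 composition (`A1_inputs`)

Tier-6 sub-goal A1; the lead's M1 composition contract (STATUS l. 4494, binding): A1 exports ONE
existential handle in `A3_main`'s vocabulary — an eigenbasis `E` (t6-p3's `EigenBasis`, built in
`T6A1EigenBasis`), the rational Weil projector `pW` (the polynomial `Q([x]^*)` of `T6A1Complex`,
pre-composed with the degree-4 projection so that it takes ALL of `H^*(B, ℚ)` into `weilQ K`), with:
`pW` takes values in the rational Weil line, preserves the algebraic classes (`D.alg_pull`), and its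
complex form on `H⁴(B, ℚ)` is the model Weil projector (t6-p3's `T6A3Bridge.hpW_C_of_A1`). The
eigenvectors `eK` of `E` and the conjugate pairing of `E.emb` are exported with the same `E`
(`A1_inputs_full`), for t6-p2's `A2_inputs`.
-/

namespace Summit.Ventures.HodgeRepro2.T6.A1Inputs

open A1Glue A1Complex A1ProjData A3Model A3Main A3Detect A3Bridge A1EigenBasis NumberField

variable (K : Type*) [Field K] [NumberField K]

/-- The degree-4 projection of `H^*(B, ℚ) = ⋀ H¹(B, ℚ)` (Mathlib's grading of the exterior algebra). -/
noncomputable def proj4 : HB K →ₗ[ℚ] HB K := GradedAlgebra.proj (fun i : ℕ => ⋀[ℚ]^i (H1 K)) 4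

/-- `proj4` takes values in `H⁴(B, ℚ)`. -/
theorem proj4_mem (a : HB K) : proj4 K a ∈ degB K 4 := by
  rw [proj4, GradedAlgebra.proj_apply]
  exact Submodule.coe_mem _

/-- `proj4` is the identity on `H⁴(B, ℚ)`. -/
theorem proj4_of_mem {a : HB K} (ha : a ∈ degB K 4) : proj4 K a = a := by
  rw [proj4, GradedAlgebra.proj_apply]
  exact DirectSum.decompose_of_mem_same _ ha

/-- A1's handle, full form: the eigenbasis `E` with its eigenvectors `eK` and conjugate pairing, and the
Weil projector `pW` with its three properties. -/
theorem A1_inputs_full [IsGalois ℚ K] {F : FaceSetting K} (D : TransferShadow F) :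
    ∃ (E : EigenBasis K) (eK : (K →+* ℂ) → KC K) (pW : HB K →ₗ[ℚ] HB K),
      (∀ i σ, E.eB (i, σ) = LinearMap.single ℂ (fun _ : Fin 4 => KC K) i (eK σ)) ∧
      (∀ σ, eK σ ≠ 0) ∧ Submodule.span ℂ (Set.range eK) = ⊤ ∧
      (∀ ν, E.emb (ν, true) = ComplexEmbedding.conjugate (E.emb (ν, false))) ∧
      (∀ v, pW v ∈ weilQ K) ∧ (∀ v ∈ D.Alg 2, pW v ∈ D.Alg 2) ∧
      (∀ v ∈ degB K 4, extC K (pW v) =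
        modelEquiv E (modelWeilProj weilSet ((modelEquiv E).symm (extC K v)))) := by
  classical
  obtain ⟨E, eK, heB, hne, hspan, hconj, -⟩ := exists_eigenBasis K F
  obtain ⟨P⟩ := exists_weilProjData K 4
  refine ⟨E, eK, A1Complex.pW K P ∘ₗ proj4 K, heB, hne, hspan, hconj, fun v => ?_, fun v hv => ?_,
    fun v hv => ?_⟩
  · exact pW_mem_weilQ K P (proj4_mem K v)
  · rw [LinearMap.comp_apply, proj4_of_mem K (D.alg_deg 2 hv)]
    exact pW_mem_alg' K P D hv
  · rw [LinearMap.comp_apply, proj4_of_mem K hv]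
    exact hpW_C_of_A1 E P v hv

/-- A1's handle in the lead's contract form (STATUS l. 4494). -/
theorem A1_inputs [IsGalois ℚ K] {F : FaceSetting K} (D : TransferShadow F) :
    ∃ (E : EigenBasis K) (pW : HB K →ₗ[ℚ] HB K),
      (∀ v, pW v ∈ weilQ K) ∧ (∀ v ∈ D.Alg 2, pW v ∈ D.Alg 2) ∧
      (∀ v ∈ degB K 4, extC K (pW v) =
        modelEquiv E (modelWeilProj weilSet ((modelEquiv E).symm (extC K v)))) := by
  obtain ⟨E, -, pW, -, -, -, -, h1, h2, h3⟩ := A1_inputs_full K D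
  exact ⟨E, pW, h1, h2, h3⟩

end Summit.Ventures.HodgeRepro2.T6.A1Inputs
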